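import Summits.QuantumFields.YangMills.Theorems.BalabanUVNodesN17RunWindowShift

/-!
# NODE N17 (NE4) — THE TWO-RUN EDITION OF THE LEVER: node N17's scale shift read ONLY ON PAIRS OF HONEST, INFRARED-MATCHED RG RUNS of (0.20)
# ⟹ DEF-1's run letters `RunConstRemainder` ∕ `RunRemAt` BY NAME; and the two-run letter ⟸ node U2's input triple (box NE4 + history moduli with fading memory)

Cell `pub-ymgap`, YM-PLAN Track A (HUMAN RULINGS D-0062 ∕ D-0149), WIDTH SEAT `pub-ymgap-dag-n17-w1` (generation 6), on dag-lead g17's word «n17-w1 take P1»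
(INBOX l.36107).  Key K3⁸ stmt-QuantumFields-27366 `SpineGivenEndpointR13SepCoPHV` (`--kind proof --supports stmt-QuantumFields-27366 --as helper`, COUNT-NEUTRAL).
Continues this seat's FILE 1 (p600401 `…N17RunRemAtOfShiftAnchor`: the lever from node N17's BOX letter), FILE 2 (p602302 `…Level`) and FILE 5 (p608124
`…N17RunWindowShift`: the lever keyed on SLIDING WINDOWS of ONE in-window run), and answers the located item F5 (δ) of `HOME/pub-ymgap-dag-n17-w1/F5-ANSWER-n17-w1-g4.md`
(«the fully TWO-RUN edition … needs in addition a window-stability side letter — LOCATED, not typed»).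

THE POINT (and one correction to F5 (δ) found while typing it).  Node N17's letter `N17At D u := T4CouplingMatching.ScaleShiftRate c ρ γ D.βfun` compares
`β_{k+2}(g_0,…,g_{k+1})` with `β_{k+1}(g_1,…,g_{k+1})` at EVERY history of the box (`Fin.tail`); FILE 5 read it along sliding windows of one honest run — but a window
`(g_{j+1},…,g_{j+k+1})` of an honest run is NOT itself a run of anything (that it nearly is, is NE4's content).  The reading in which BOTH histories are honest runs is
Bałaban's own two-run frame ([I] Thm 2 p. 259; `T4CouplingMatching`'s MODELLING POINT): run B with `k+2` couplings `(g_0,…,g_{k+1})` and run A with `k+1` couplings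
`(h_0,…,h_k)`, both solutions of (0.20) inside `]0,γ]`, with the SAME renormalised (infrared) endpoint `h_k = g_{k+1}` — and the letter compares the β-function each run's
LAST fluctuation integral produces: (TR) `|β_{k+1}(g_0,…,g_{k+1}) − β_k(h_0,…,h_k)| ≤ a_k`.  F5 (δ) proposed the ULTRAVIOLET-matched second run («from g₁»); that choice
does not iterate: each peel re-runs forward from the next coupling and the peeled runs drift apart additively in `1∕g²` (m peels cost `m·Σa` of window), so its
«window-stability side letter» is not a fixed-window statement.  INFRARED-matched peels all END AT THE SAME COUPLING `g_k ≤ γ_s`, so every peeled run lies in the SAME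
window for free, and the side letter collapses to (ER) «for every level `γ′ ≤ γ`, every `k` and every endpoint `g ∈ ]0,γ′]` SOME `k`-step solution of (0.20) inside `]0,γ′]`
ends at `g`» — the existence half of [I] Thm 2's tuning, which the TREE proves from the SIGN of β, continuity and the printed upper bound
(`FlowStep.bare_coupling_exists_of_betaNonneg`; `endRuns_of_betaSign_cont_upper` below).

WHAT THIS FILE PROVES (theorems only; 0 `def`, 0 `instance`, 0 `sorry`; the texts (TR) ∕ (ER) are spelled INLINE as binders):
§1 generic `β : HBeta` — `endRuns_of_betaSign_cont_upper` ((ER) ⟸ `BetaLowerH 0` ∧ `BetaContH` ∧ `BetaUpperH`, tree BY NAME); `twoRunShift_mono` (level restriction);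
   `remTwoRunShift_of_twoRunShift_cornerStep` (one IR-matched peel against reference numbers `b` with corner step `e`); `exists_peeledRun_rem_le` (m peels:
   `∃` a `k₀`-step in-window run `hs` with `hs k₀ = gs (k₀+m)` and `|β_{k₀+m}(gs-prefix) − b_{k₀+m}| ≤ |β_{k₀}(hs-prefix) − b_{k₀}| + Σ_{i<m}(a+e)_{k₀+i}`);
   ★ `exists_runConstRemainder_of_twoRunShift_cornerStep_scaleAnchor_endRuns` (DEF-1's ANCHOR + summable (TR) + summable corner step + (ER) ⟹ `∀ s > 0 ∃ γ_s ∈ ]0,γ]`,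
   `RunConstRemainder β b s γ_s` — FILE 5's proof with the peel lemma in place of the window telescope; NO box letter, NO off-run history);
   ★ `twoRunShift_of_scaleShift_histLipschitz_fadingMemory` (node U2's INPUT TRIPLE `ScaleShiftRate c θ γ` ∧ `HistLipschitz Λ γ` ∧ `FadingMemory C θ Λ` + the per-pair AF
   weight bound `Σ_{i≤K}(g^A_i)² g^B_{i+1} ≤ U` + node U2's window `C·U ≤ (1−θ)∕2` ⟹ (TR) with `a_k = 2c·θ^k`: split through `β_K(Fin.tail ·)`, the history half is
   `Σ Λ_{K,i}(g^A_i)²g^B_{i+1}·disc_i` (`abs_sub_le_of_inv_sq`) and `disc_i ≤ (2c∕(1−θ))θ^i` is the tree's `disc_le_of_fadingMemory` — so the two-run letter is WEAKER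
   than node U2's triple under U2's own window), `twoRunShift_of_scaleShift_histLipschitz_fadingMemory_eventualLower` (weight bound discharged by `EventualLowerH b γ k₀`,
   `sum_weights_le_of_eventualLower`, `U := (k₀+1)γ³ + 2γ∕b`).
§2 at NODE 00's Stage-13 record (`N = 2`) — ★★ `runRemAt_of_twoRunShift_scaleAnchor_endRuns_survContAt` (admissible θ · summable (TR) of the datum's β at level `θ.γ` · (ER) ·
   `ScaleAnchor … (θ.cβ • beta0OfJs F κ)` · ONE-level `SurvCont` ⟹ DEF-1's `RunRemAt F κ θ hP θ.cβ`; the corner step of the scaled named numbers is the TREE's, FILE 5 §2);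
   `runRemAt_iff_anchor_survCont_of_twoRunShift_endRuns`; ★★ `twoRunShift_of_n17At_histModuli` (node N17's letter `N17At D u` at a bundle with `u.γ = θ.γ`, `0 < u.ρ < 1` +
   history moduli of the datum's β with fading memory at the same rate + the AF weight ∕ window binders ⟹ (TR) with `a_k = 2(u.cr·u.C₅·u.θ)·u.ρ^k`).
§3 model sanity (A6) — `twoRunShift_const`, `exists_runConstRemainder_const`: ★'s binder SET is jointly satisfiable (constant family; a TRIVIAL inhabitant, nothing of Bałaban).
THE THREE KEYINGS OF NODE N17's INPUT: BOX (FILE 1) ⟹ RUN-WINDOW (FILE 5); BOX + node U2's history∕memory companions + window ⟹ TWO-RUN (this file); RUN-WINDOW and TWO-RUN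
are incomparable as shapes; all three give EVERY run-wise constant remainder (also the remainder currency of K1⁹'s `stub_runRows13PWS` — n24's lane, nothing keyed there here).
F-E STATUS (located, not mine: ym-nodeO CRIT-2 g3 E-CRIT2-2 ∕ CRIT-1 g6 `Cruxes/EndpointGivenBR13SepCoPH/CRIT-1-CROSSREAD-E-CRIT2-2-geometric-letters.md`, kernel shadows
`…/Idea5g12RunCurrencySketch5.lean` §11·N): modulo H_FE′ (the record's free-history β FIRST-ENTRY-ONLY) + the transport identification (T), the GEOMETRIC BOX letters `ScaleShiftRate`
(node N17's `N17At`) and `FadingMemory` are presumptively FALSE at the CURRENT record — so `twoRunShift_of_scaleShift_histLipschitz_fadingMemory[_eventualLower]` (§1) and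
`twoRunShift_of_n17At_histModuli` (§2) are, THERE, conditionals with a presumptively-false antecedent (harmless as theorems, dead as supplier roads until the F-E repair), while the
LEVER ★ ∕ ★★ reads only (TR) + (ER) + anchor + (C): RUN currency, untouched by the finding (mod (T) the IR-matched two-run shift compares β at the SAME realised coupling — pv16's
`scaleShiftRate_ofMarkov_iff` direction), and asks only SUMMABILITY of `a`, no geometric rate.  N17-side kernel shadows of F-E: this seat's next file, not here.

HONEST SCOPE (A6, director-ym №189).  Elementary real bookkeeping over hypothesis SHAPES + tree facts BY NAME; (TR), (ER), the anchor, (C), the history moduli are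
HYPOTHESES inhabited at no θ here (instance 0∕1); (TR) is NOT a registered stub and NOT proposed for registration; §2 quantifies over `θ : Stage13HParams F 2` with
`hP : θ.Provisos₁₃SepCoPH F 2` — inhabited iff K0⁷ (stmt-QuantumFields-20541).  NOTHING of Bałaban is asserted or instantiated: NE4 NOT IN PRINT ([Balaban1987RG1] p. 264
«We will investigate other properties in a separate paper»; GAPS G-t4-U2-1) and NOT proved in any keying; NOT a proof of `stub_rates13HV`, `stub_expansion13HV` or any K1⁹ stub;
N17 NOT discharged (DEPENDENT∕DERIVED row); K0⁷ ∕ K1⁹ ∕ K3⁸ OPEN; counts UNMOVED (typed 28∕28 · discharged 5∕27 · A 5∕28).  One finite four-torus programme at fixed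
`ε = L^{−K}`, Bałaban AS PRINTED; the YM mass gap (Clay) is NOT proved by any of this — R4 closes the conditional finite-𝕋⁴ rung `BalabanLadder.UV` only; nothing continuum ∕ ℝ⁴ ∕ OS.
[I] = [Balaban1987RG1] T. Bałaban, CMP **109** (1987): (0.20) p. 256, Thm 2 p. 259, (1.20)–(1.22) p. 264, Thm 3 p. 264, (2.12)–(2.14) p. 268, §5 p. 298.
-/

noncomputable section

namespace Summit.QuantumFields.YangMills.BalabanUVNodes.N17TwoRunShift

open Literature.MathematicalPhysics.QuantumFieldTheory.Balaban1983to89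
open Literature.MathematicalPhysics.QuantumFieldTheory.Balaban1983to89.FlowStep
open Literature.MathematicalPhysics.QuantumFieldTheory.Balaban1983to89.T4CouplingMatching
  (ScaleShiftRate HistLipschitz FadingMemory EventualLowerH disc disc_nonneg disc_le_of_fadingMemory abs_sub_le_of_inv_sq tail_prefixOf
    sum_weights_le_of_eventualLower)
open Literature.MathematicalPhysics.QuantumFieldTheory.Balaban1983to89.B12Beta (HistBox)
open Literature.MathematicalPhysics.QuantumFieldTheory.Balaban1983to89.T4Continuum (T4Family)
open Summit.QuantumFields.YangMills.Theorems.BalabanUVNodesK2JsOfRecord (StepColourData beta0OfJs)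
open Summit.QuantumFields.YangMills.Theorems.BalabanUVNodesK2NamedJetsRemAt (ScaleAnchor)
open Summit.QuantumFields.YangMills.Theorems.BalabanUVNodesK2NamedJetsRunRemAt (RunRemAt RunConstRemainder SurvCont)
open Summit.QuantumFields.YangMills.BalabanUVNodes.N17RunRemAtOfShiftAnchor (scaleAnchor_upTo cβ_mul_stepBal_pos scaleShiftRate_of_n17At_window)
open Summit.QuantumFields.YangMills.BalabanUVNodes.N17RunWindowShift (exists_cornerStep_smul_beta0OfJs exists_runLetters_of_everyRunConst_survContAt)
open Finset Filter Topology

/-! ## §1 Generic (`β : HBeta`): the lever keyed on PAIRS OF INFRARED-MATCHED IN-WINDOW RUNS, and the two-run letter from node U2's triple -/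

section Generic

variable {β : HBeta} {b a e : ℕ → ℝ} {γ : ℝ}

/-- **(ER) ⟸ SIGN + CONTINUITY + THE PRINTED UPPER BOUND** (the existence half of [I] Thm 2's tuning, = the tree's `FlowStep.bare_coupling_exists_of_betaNonneg` BY NAME, read
at every level `γ′ ≤ γ` — the three binders restrict to the smaller boxes): for every `γ′ ∈ ]0,γ]`, every `k` and every endpoint `g ∈ ]0,γ′]` some `k`-step solution of (0.20)
inside `]0,γ′]` ends at `g`.  The β-side binders are UNPRINTED except the upper bound. [cite: Balaban1987RG1, Thm 2 p.259 and §1 p.264] -/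
theorem endRuns_of_betaSign_cont_upper {β' : ℝ} (hβ' : 0 ≤ β') (hcont : BetaContH γ β) (hsign : BetaLowerH 0 γ β) (hhi : BetaUpperH β' γ β) :
    ∀ γ' : ℝ, 0 < γ' → γ' ≤ γ → ∀ (k : ℕ) (g : ℝ), 0 < g → g ≤ γ' →
      ∃ hs : ℕ → ℝ, RGEqH k β hs ∧ Step.InInterval γ' k hs ∧ hs k = g := by
  intro γ' hγ' hle k g hg hgγ'
  obtain ⟨gs, hK, hrg, hI, -⟩ := bare_coupling_exists_of_betaNonneg β hγ' hβ' (fun j => (hcont j).mono (box_mono hle j))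
    (fun j v hv => hsign j v (box_mono hle j hv)) (fun j v hv => hhi j v (box_mono hle j hv)) k g hg hgγ'
  exact ⟨gs, hrg, hI, hK⟩

/-- (TR) restricts to every smaller level (in-window runs of level `γ′ ≤ γ` are in-window runs of level `γ`). [folklore] -/
theorem twoRunShift_mono {γ' : ℝ} (hle : γ' ≤ γ)
    (hT : ∀ (k : ℕ) (gs hs : ℕ → ℝ), RGEqH (k + 1) β gs → Step.InInterval γ (k + 1) gs → RGEqH k β hs → Step.InInterval γ k hs →
      hs k = gs (k + 1) → |β (k + 1) (prefixOf gs (k + 1)) - β k (prefixOf hs k)| ≤ a k) :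
    ∀ (k : ℕ) (gs hs : ℕ → ℝ), RGEqH (k + 1) β gs → Step.InInterval γ' (k + 1) gs → RGEqH k β hs → Step.InInterval γ' k hs →
      hs k = gs (k + 1) → |β (k + 1) (prefixOf gs (k + 1)) - β k (prefixOf hs k)| ≤ a k :=
  fun k gs hs hg hIg hh hIh hend =>
    hT k gs hs hg (fun i hi => ⟨(hIg i hi).1, (hIg i hi).2.trans hle⟩) hh (fun i hi => ⟨(hIh i hi).1, (hIh i hi).2.trans hle⟩) hend

/-- **ONE INFRARED-MATCHED PEEL AGAINST THE REFERENCE NUMBERS**: along an IR-matched pair (run B `gs` with `k+2` couplings, run A `hs` with `k+1`, `hs k = gs (k+1)`), the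
«remainder» `β_·(·) − b_·` changes by at most `a_k + e_k` (two-run shift (TR) + corner step `|b_{k+1} − b_k| ≤ e_k`).  Both inputs are hypothesis TEXTS.
[cite: Balaban1987RG1, (1.20)-(1.22) p.264 and (2.12)-(2.14) p.268] -/
theorem remTwoRunShift_of_twoRunShift_cornerStep
    (hT : ∀ (k : ℕ) (gs hs : ℕ → ℝ), RGEqH (k + 1) β gs → Step.InInterval γ (k + 1) gs → RGEqH k β hs → Step.InInterval γ k hs →
      hs k = gs (k + 1) → |β (k + 1) (prefixOf gs (k + 1)) - β k (prefixOf hs k)| ≤ a k)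
    (hb : ∀ k, |b (k + 1) - b k| ≤ e k) {k : ℕ} {gs hs : ℕ → ℝ} (hg : RGEqH (k + 1) β gs) (hIg : Step.InInterval γ (k + 1) gs)
    (hh : RGEqH k β hs) (hIh : Step.InInterval γ k hs) (hend : hs k = gs (k + 1)) :
    |(β (k + 1) (prefixOf gs (k + 1)) - b (k + 1)) - (β k (prefixOf hs k) - b k)| ≤ a k + e k := by
  have h1 := hT k gs hs hg hIg hh hIh hend
  have h2 := hb k
  have e₁ : (β (k + 1) (prefixOf gs (k + 1)) - b (k + 1)) - (β k (prefixOf hs k) - b k)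
      = (β (k + 1) (prefixOf gs (k + 1)) - β k (prefixOf hs k)) - (b (k + 1) - b k) := by ring
  rw [e₁]
  exact (abs_sub _ _).trans (add_le_add h1 h2)

/-- **TELESCOPING THROUGH `m` INFRARED-MATCHED PEELS** (two-run twin of FILE 5's `rem_window_iterate`): under (TR), the corner step and (ER) AT ONE LEVEL `γ`, every
`(k₀+m)`-step in-window run `gs` admits a `k₀`-step in-window run `hs` of the SAME level with the SAME endpoint, `hs k₀ = gs (k₀+m)`, and
`|β_{k₀+m}(g_0,…,g_{k₀+m}) − b_{k₀+m}| ≤ |β_{k₀}(h_0,…,h_{k₀}) − b_{k₀}| + Σ_{i<m} (a_{k₀+i} + e_{k₀+i})` (induction on `m`: peel the IR-matched `(k₀+m)`-step run that (ER)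
supplies at the endpoint `gs (k₀+m+1) ∈ ]0,γ]`, then recurse).  Every peeled run ends at the same coupling, so no window is lost. [cite: Balaban1987RG1, Thm 2 p.259 and (0.20) p.256] -/
theorem exists_peeledRun_rem_le
    (hT : ∀ (k : ℕ) (gs hs : ℕ → ℝ), RGEqH (k + 1) β gs → Step.InInterval γ (k + 1) gs → RGEqH k β hs → Step.InInterval γ k hs →
      hs k = gs (k + 1) → |β (k + 1) (prefixOf gs (k + 1)) - β k (prefixOf hs k)| ≤ a k)
    (hb : ∀ k, |b (k + 1) - b k| ≤ e k)
    (hE : ∀ (k : ℕ) (g : ℝ), 0 < g → g ≤ γ → ∃ hs : ℕ → ℝ, RGEqH k β hs ∧ Step.InInterval γ k hs ∧ hs k = g) (k₀ : ℕ) :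
    ∀ (m : ℕ) (gs : ℕ → ℝ), RGEqH (k₀ + m) β gs → Step.InInterval γ (k₀ + m) gs →
      ∃ hs : ℕ → ℝ, RGEqH k₀ β hs ∧ Step.InInterval γ k₀ hs ∧ hs k₀ = gs (k₀ + m) ∧
        |β (k₀ + m) (prefixOf gs (k₀ + m)) - b (k₀ + m)| ≤ |β k₀ (prefixOf hs k₀) - b k₀| + ∑ i ∈ range m, (a (k₀ + i) + e (k₀ + i)) := by
  intro m
  induction m with
  | zero =>
    intro gs hrg hI
    exact ⟨gs, hrg, hI, rfl, by simp only [Nat.add_zero, Finset.sum_range_zero, add_zero, le_refl]⟩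
  | succ m ih =>
    intro gs hrg hI
    have hrg' : RGEqH (k₀ + m + 1) β gs := hrg
    have hI' : Step.InInterval γ (k₀ + m + 1) gs := hI
    obtain ⟨hs₁, hrg₁, hI₁, hend₁⟩ := hE (k₀ + m) (gs (k₀ + m + 1)) (hI' _ le_rfl).1 (hI' _ le_rfl).2
    have hstep := remTwoRunShift_of_twoRunShift_cornerStep hT hb hrg' hI' hrg₁ hI₁ hend₁
    obtain ⟨hs, hrgh, hIh, hendh, hle⟩ := ih hs₁ hrg₁ hI₁
    refine ⟨hs, hrgh, hIh, hendh.trans hend₁, ?_⟩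
    have htri : |β (k₀ + m + 1) (prefixOf gs (k₀ + m + 1)) - b (k₀ + m + 1)| - |β (k₀ + m) (prefixOf hs₁ (k₀ + m)) - b (k₀ + m)| ≤
        |(β (k₀ + m + 1) (prefixOf gs (k₀ + m + 1)) - b (k₀ + m + 1)) - (β (k₀ + m) (prefixOf hs₁ (k₀ + m)) - b (k₀ + m))| :=
      abs_sub_abs_le_abs_sub _ _
    rw [Finset.sum_range_succ]
    show |β (k₀ + m + 1) (prefixOf gs (k₀ + m + 1)) - b (k₀ + m + 1)| ≤
      |β k₀ (prefixOf hs k₀) - b k₀| + (∑ i ∈ range m, (a (k₀ + i) + e (k₀ + i)) + (a (k₀ + m) + e (k₀ + m)))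
    linarith

/-- ★ **THE TWO-RUN LEVER: DEF-1's ANCHOR + a SUMMABLE two-run shift (TR) + a SUMMABLE corner step + end-runs (ER) at every level ⟹ EVERY RUN-WISE CONSTANT REMAINDER at a
small enough level** — `∀ s > 0 ∃ γ_s ∈ ]0,γ]`, `RunConstRemainder β b s γ_s`.  Given `s`: pass to `|a|`, pick `k₀` with the tail `Σ_i (|a|+e)_{k₀+i} < s∕2`
(`tendsto_sum_nat_add`), ONE anchor radius `γ_a` for the scales `k ≤ k₀` at tolerance `s∕2` (FILE 1's `scaleAnchor_upTo`), level `γ_s := min γ γ_a`; for `k ≤ k₀` the run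
prefix lies in the anchor box; for `k = k₀ + m` peel `m` times INSIDE level `γ_s` (`exists_peeledRun_rem_le` with (TR) restricted and (ER) read at `γ_s`) — the peeled
`k₀`-step run lies in `]0,γ_s] ⊆ ]0,γ_a]`, so the anchor bounds the base term.  NO box letter and NO off-run history is read.
[cite: Balaban1987RG1, Thm 2 p.259, Thm 3 p.264, (1.20)-(1.22) p.264 and (2.12)-(2.14) p.268] -/
theorem exists_runConstRemainder_of_twoRunShift_cornerStep_scaleAnchor_endRuns (hγ : 0 < γ) (hA : ScaleAnchor β b)
    (hT : ∀ (k : ℕ) (gs hs : ℕ → ℝ), RGEqH (k + 1) β gs → Step.InInterval γ (k + 1) gs → RGEqH k β hs → Step.InInterval γ k hs →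
      hs k = gs (k + 1) → |β (k + 1) (prefixOf gs (k + 1)) - β k (prefixOf hs k)| ≤ a k)
    (ha : Summable a) (hb : ∀ k, |b (k + 1) - b k| ≤ e k) (he : Summable e)
    (hE : ∀ γ' : ℝ, 0 < γ' → γ' ≤ γ → ∀ (k : ℕ) (g : ℝ), 0 < g → g ≤ γ' →
      ∃ hs : ℕ → ℝ, RGEqH k β hs ∧ Step.InInterval γ' k hs ∧ hs k = g)
    {s : ℝ} (hs : 0 < s) :
    ∃ γs : ℝ, 0 < γs ∧ γs ≤ γ ∧ RunConstRemainder β b s γs := by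
  have hT' : ∀ (k : ℕ) (gs hs : ℕ → ℝ), RGEqH (k + 1) β gs → Step.InInterval γ (k + 1) gs → RGEqH k β hs → Step.InInterval γ k hs →
      hs k = gs (k + 1) → |β (k + 1) (prefixOf gs (k + 1)) - β k (prefixOf hs k)| ≤ |a k| :=
    fun k gs hs hg hIg hh hIh hend => (hT k gs hs hg hIg hh hIh hend).trans (le_abs_self _)
  have hf0 : ∀ k, 0 ≤ |a k| + e k := fun k => add_nonneg (abs_nonneg _) ((abs_nonneg _).trans (hb k))
  have hf : Summable fun k => |a k| + e k := ha.abs.add he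
  have htail : Tendsto (fun i => ∑' j, (|a (j + i)| + e (j + i))) atTop (𝓝 0) := tendsto_sum_nat_add fun k => |a k| + e k
  obtain ⟨k₀, hk₀⟩ := (htail.eventually (gt_mem_nhds (half_pos hs))).exists
  obtain ⟨γa, hγa, hanchor⟩ := scaleAnchor_upTo hA k₀ (half_pos hs)
  have hγs : 0 < min γ γa := lt_min hγ hγa
  refine ⟨min γ γa, hγs, min_le_left _ _, ?_⟩
  have hTs := twoRunShift_mono (min_le_left γ γa) hT'
  have hEs := hE (min γ γa) hγs (min_le_left _ _)
  intro n gs hrg hI k hk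
  have hIa : ∀ i, i ≤ n → 0 < gs i ∧ gs i ≤ γa := fun i hi => ⟨(hI i hi).1, (hI i hi).2.trans (min_le_right _ _)⟩
  rcases Nat.lt_or_ge k₀ k with hlt | hge
  · obtain ⟨m, rfl⟩ := Nat.exists_eq_add_of_le hlt.le
    have hrgk : RGEqH (k₀ + m) β gs := fun j hj => hrg j (lt_of_lt_of_le hj hk)
    have hIk : Step.InInterval (min γ γa) (k₀ + m) gs := fun i hi => hI i (hi.trans hk)
    obtain ⟨hs', -, hI', -, hiter⟩ := exists_peeledRun_rem_le hTs hb hEs k₀ m gs hrgk hIk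
    have hbase : |β k₀ (prefixOf hs' k₀) - b k₀| ≤ s / 2 :=
      hanchor k₀ le_rfl _ fun i => ⟨(hI' i (Nat.le_of_lt_succ i.isLt)).1, (hI' i (Nat.le_of_lt_succ i.isLt)).2.trans (min_le_right _ _)⟩
    have hsumk : Summable fun j => |a (j + k₀)| + e (j + k₀) := (summable_nat_add_iff k₀).2 hf
    have hpart : ∑ i ∈ range m, (|a (k₀ + i)| + e (k₀ + i)) ≤ ∑' j, (|a (j + k₀)| + e (j + k₀)) := by
      have e₁ : ∑ i ∈ range m, (|a (k₀ + i)| + e (k₀ + i)) = ∑ i ∈ range m, (|a (i + k₀)| + e (i + k₀)) :=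
        Finset.sum_congr rfl fun i _ => by rw [Nat.add_comm]
      rw [e₁]
      exact hsumk.sum_le_tsum (range m) fun j _ => hf0 _
    have htl : ∑' j, (|a (j + k₀)| + e (j + k₀)) < s / 2 := hk₀
    exact hiter.trans (by linarith)
  · exact (hanchor k hge (prefixOf gs k) fun i => hIa i ((Nat.le_of_lt_succ i.isLt).trans hk)).trans (half_le_self hs.le)

/-- ★ **THE TWO-RUN LETTER ⟸ NODE U2's INPUT TRIPLE UNDER U2's OWN WINDOW.**  Box NE4 `ScaleShiftRate c θ γ β` (node N17 proper), history moduli `HistLipschitz Λ γ β` with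
fading memory `FadingMemory C θ Λ` (node N22's currency read at the β-family; one rate `θ` shared — rates can always be worsened), the per-pair asymptotic-freedom weight bound
`Σ_{i≤K} (g^A_i)² g^B_{i+1} ≤ U` and node U2's window `C·U ≤ (1−θ)∕2` give (TR) with modulus `a_k = 2c·θ^k` on EVERY IR-matched in-window pair.  Proof: split through
`β_K(Fin.tail(g^B-prefix)) = β_K(g^B_1,…,g^B_{K+1})`; the scale half is `≤ cθ^K` (box NE4); the history half is `≤ Σ_i Λ_{K,i}·(g^A_i)²g^B_{i+1}·disc_i`
(`abs_sub_le_of_inv_sq`) with the tree's K-UNIFORM matching `disc_i ≤ (2c∕(1−θ))θ^i` (`T4CouplingMatching.disc_le_of_fadingMemory`), and `θ^{K−i}θ^i = θ^K` sums to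
`(2cCU∕(1−θ))θ^K ≤ cθ^K`.  Every β-side binder UNPRINTED. [cite: Balaban1987RG1, (0.20) p.256, (1.20)-(1.22) p.264 and §5 p.298] -/
theorem twoRunShift_of_scaleShift_histLipschitz_fadingMemory {c θ C U : ℝ} {Λ : ℕ → ℕ → ℝ}
    (hθ0 : 0 < θ) (hθ1 : θ < 1) (hc : 0 ≤ c) (hC : 0 ≤ C)
    (hS : ScaleShiftRate c θ γ β) (hL : HistLipschitz Λ γ β) (hΛ : FadingMemory C θ Λ)
    (hU : ∀ (K : ℕ) (gA gB : ℕ → ℝ), RGEqH K β gA → Step.InInterval γ K gA → RGEqH (K + 1) β gB → Step.InInterval γ (K + 1) gB →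
      gA K = gB (K + 1) → ∑ i ∈ range (K + 1), (gA i) ^ 2 * gB (i + 1) ≤ U)
    (hsmall : C * U ≤ (1 - θ) / 2) :
    ∀ (k : ℕ) (gs hs : ℕ → ℝ), RGEqH (k + 1) β gs → Step.InInterval γ (k + 1) gs → RGEqH k β hs → Step.InInterval γ k hs →
      hs k = gs (k + 1) → |β (k + 1) (prefixOf gs (k + 1)) - β k (prefixOf hs k)| ≤ 2 * c * θ ^ k := by
  intro K gB gA hB hIB hA hIA hpin
  have hUK := hU K gA gB hA hIA hB hIB hpin
  have hdisc := disc_le_of_fadingMemory hθ0 hθ1 hc hC hA hB hIA hIB hpin hS hL hΛ hUK hsmall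
  have hwbox : prefixOf gB (K + 1) ∈ Box γ (K + 1) := T4CouplingMatching.prefixOf_mem_box le_rfl hIB
  have htail : Fin.tail (prefixOf gB (K + 1)) ∈ Box γ K := by
    rw [tail_prefixOf]
    exact T4CouplingMatching.prefixOf_mem_box (N := K) le_rfl fun i hi => hIB (i + 1) (by omega)
  have hpA : prefixOf gA K ∈ Box γ K := T4CouplingMatching.prefixOf_mem_box le_rfl hIA
  have h1 := hS K (prefixOf gB (K + 1)) hwbox
  have h2 := hL K (Fin.tail (prefixOf gB (K + 1))) (prefixOf gA K) htail hpA
  have h3 : ∑ i : Fin (K + 1), Λ K i * |Fin.tail (prefixOf gB (K + 1)) i - prefixOf gA K i|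
      ≤ ∑ i ∈ range (K + 1), Λ K i * ((gA i) ^ 2 * gB (i + 1)) * disc gA gB i := by
    rw [Finset.sum_range (fun i => Λ K i * ((gA i) ^ 2 * gB (i + 1)) * disc gA gB i)]
    refine Finset.sum_le_sum fun i _ => ?_
    have hiK : (i : ℕ) ≤ K := Nat.lt_succ_iff.mp i.isLt
    have hgA := hIA i hiK
    have hgB := hIB (i + 1) (by omega)
    simp only [Fin.tail, prefixOf_apply, Fin.val_succ]
    rw [abs_sub_comm, mul_assoc]
    exact mul_le_mul_of_nonneg_left (abs_sub_le_of_inv_sq hgA.1 hgB.1) (hΛ K i hiK).1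
  have h4 : ∑ i ∈ range (K + 1), Λ K i * ((gA i) ^ 2 * gB (i + 1)) * disc gA gB i
      ≤ C * θ ^ K * (2 * c / (1 - θ)) * U := by
    have hw : ∀ i ∈ range (K + 1), 0 ≤ (gA i) ^ 2 * gB (i + 1) := fun i hi =>
      mul_nonneg (sq_nonneg _) (hIB (i + 1) (by have := mem_range.mp hi; omega)).1.le
    calc ∑ i ∈ range (K + 1), Λ K i * ((gA i) ^ 2 * gB (i + 1)) * disc gA gB i
        ≤ ∑ i ∈ range (K + 1), C * θ ^ K * (2 * c / (1 - θ)) * ((gA i) ^ 2 * gB (i + 1)) := by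
          refine Finset.sum_le_sum fun i hi => ?_
          have hiK : i ≤ K := Nat.lt_succ_iff.mp (mem_range.mp hi)
          have hwi := hw i hi
          have hΛi := hΛ K i hiK
          have hdi := hdisc i hiK
          have hθKi : θ ^ (K - i) * θ ^ i = θ ^ K := by rw [← pow_add, Nat.sub_add_cancel hiK]
          calc Λ K i * ((gA i) ^ 2 * gB (i + 1)) * disc gA gB i
              ≤ (C * θ ^ (K - i)) * ((gA i) ^ 2 * gB (i + 1)) * (2 * c / (1 - θ) * θ ^ i) :=
                mul_le_mul (mul_le_mul_of_nonneg_right hΛi.2 hwi) hdi (disc_nonneg _ _ _)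
                  (mul_nonneg (mul_nonneg hC (pow_nonneg hθ0.le _)) hwi)
            _ = C * (θ ^ (K - i) * θ ^ i) * (2 * c / (1 - θ)) * ((gA i) ^ 2 * gB (i + 1)) := by ring
            _ = C * θ ^ K * (2 * c / (1 - θ)) * ((gA i) ^ 2 * gB (i + 1)) := by rw [hθKi]
      _ = C * θ ^ K * (2 * c / (1 - θ)) * ∑ i ∈ range (K + 1), (gA i) ^ 2 * gB (i + 1) := by rw [Finset.mul_sum]
      _ ≤ C * θ ^ K * (2 * c / (1 - θ)) * U :=
          mul_le_mul_of_nonneg_left hUK (mul_nonneg (mul_nonneg hC (pow_nonneg hθ0.le _))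
            (div_nonneg (mul_nonneg two_pos.le hc) (by linarith)))
  have h5 : C * θ ^ K * (2 * c / (1 - θ)) * U ≤ c * θ ^ K := by
    have h1θ : 0 < 1 - θ := by linarith
    have e₁ : C * θ ^ K * (2 * c / (1 - θ)) * U = (C * U * (2 * c) * θ ^ K) / (1 - θ) := by
      field_simp
    rw [e₁, div_le_iff₀ h1θ]
    have h6 : C * U * (2 * c) ≤ (1 - θ) / 2 * (2 * c) := mul_le_mul_of_nonneg_right hsmall (by linarith)
    calc C * U * (2 * c) * θ ^ K ≤ (1 - θ) / 2 * (2 * c) * θ ^ K := mul_le_mul_of_nonneg_right h6 (pow_nonneg hθ0.le _)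
      _ = c * θ ^ K * (1 - θ) := by ring
  calc |β (K + 1) (prefixOf gB (K + 1)) - β K (prefixOf gA K)|
      ≤ |β (K + 1) (prefixOf gB (K + 1)) - β K (Fin.tail (prefixOf gB (K + 1)))| +
          |β K (Fin.tail (prefixOf gB (K + 1))) - β K (prefixOf gA K)| := abs_sub_le _ _ _
    _ ≤ c * θ ^ K + c * θ ^ K := add_le_add h1 (h2.trans (h3.trans (h4.trans h5)))
    _ = 2 * c * θ ^ K := by ring

/-- The same with the per-pair weight bound DISCHARGED by an eventual lower bound `EventualLowerH b γ k₀ β` (`b > 0`, asymptotic freedom from scale `k₀` on; the tree's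
`sum_weights_le_of_eventualLower`, `U := (k₀+1)γ³ + 2γ∕b`, the pin is not even used): node U2's window then reads `C·((k₀+1)γ³ + 2γ∕b) ≤ (1−θ)∕2`.  Every β-side binder
UNPRINTED. [cite: Balaban1987RG1, Thm 2 (0.31) p.259 and (1.20)-(1.22) p.264] -/
theorem twoRunShift_of_scaleShift_histLipschitz_fadingMemory_eventualLower {c θ C b' : ℝ} {k₀ : ℕ} {Λ : ℕ → ℕ → ℝ}
    (hγ : 0 < γ) (hb' : 0 < b') (hθ0 : 0 < θ) (hθ1 : θ < 1) (hc : 0 ≤ c) (hC : 0 ≤ C)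
    (hS : ScaleShiftRate c θ γ β) (hL : HistLipschitz Λ γ β) (hΛ : FadingMemory C θ Λ) (hlo : EventualLowerH b' γ k₀ β)
    (hsmall : C * (((k₀ : ℝ) + 1) * γ ^ 3 + 2 * γ / b') ≤ (1 - θ) / 2) :
    ∀ (k : ℕ) (gs hs : ℕ → ℝ), RGEqH (k + 1) β gs → Step.InInterval γ (k + 1) gs → RGEqH k β hs → Step.InInterval γ k hs →
      hs k = gs (k + 1) → |β (k + 1) (prefixOf gs (k + 1)) - β k (prefixOf hs k)| ≤ 2 * c * θ ^ k :=
  twoRunShift_of_scaleShift_histLipschitz_fadingMemory hθ0 hθ1 hc hC hS hL hΛ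
    (fun _ _ _ hA hIA hB hIB _ => sum_weights_le_of_eventualLower hγ hb' hA hB hIA hIB hlo) hsmall

end Generic

/-! ## §2 At NODE 00's Stage-13 record (`N = 2`): the two-run shift of the datum's β + (ER) + the anchor at the NAMED numbers + one-level (C) ⟹ DEF-1's `RunRemAt` -/

section Record

open YMDAG.UVSplit (U3Carriers N17At)

variable (F : T4Family) (κ : StepColourData) (θ : Node00.Stage13HParams F 2) (hP : θ.Provisos₁₃SepCoPH F 2)

/-- ★★ **THE TWO-RUN JUNCTION TO THE REGISTERED RUN LETTER.**  At an admissible proviso'd Stage-13 tuple: a SUMMABLE two-run shift modulus (TR) of the datum's β on the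
IR-matched in-window pairs of level `θ.γ` + end-runs (ER) at every level `≤ θ.γ` + DEF-1's ANCHOR at the named numbers `θ.cβ · beta0OfJs F κ` + survivor continuity at ONE
positive level ⟹ `RunRemAt F κ θ hP θ.cβ` (cap met with equality, `0 < θ.cβ·stepBal 2 F.L`, FILE 1's `cβ_mul_stepBal_pos`; the corner step of the scaled named numbers is the
TREE's, FILE 5 §2 `exists_cornerStep_smul_beta0OfJs`).  NO box letter, NO off-run history.  CONDITIONAL; (TR) ∕ (ER) ∕ the anchor ∕ (C) NOT proved.
[cite: Balaban1987RG1, Thm 2 p.259, Thm 3 p.264, (1.20)-(1.22) p.264 and (2.12)-(2.14) p.268] -/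
theorem runRemAt_of_twoRunShift_scaleAnchor_endRuns_survContAt (hθ : θ.Admissible F 2) {a : ℕ → ℝ} (ha : Summable a)
    (hT : ∀ (k : ℕ) (gs hs : ℕ → ℝ), RGEqH (k + 1) (Node00.datumOfRecord₁₃SepCoPH F 2 θ hP).βfun gs → Step.InInterval θ.γ (k + 1) gs →
      RGEqH k (Node00.datumOfRecord₁₃SepCoPH F 2 θ hP).βfun hs → Step.InInterval θ.γ k hs → hs k = gs (k + 1) →
      |(Node00.datumOfRecord₁₃SepCoPH F 2 θ hP).βfun (k + 1) (prefixOf gs (k + 1)) - (Node00.datumOfRecord₁₃SepCoPH F 2 θ hP).βfun k (prefixOf hs k)| ≤ a k)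
    (hE : ∀ γ' : ℝ, 0 < γ' → γ' ≤ θ.γ → ∀ (k : ℕ) (g : ℝ), 0 < g → g ≤ γ' →
      ∃ hs : ℕ → ℝ, RGEqH k (Node00.datumOfRecord₁₃SepCoPH F 2 θ hP).βfun hs ∧ Step.InInterval γ' k hs ∧ hs k = g)
    (hA : ScaleAnchor (Node00.datumOfRecord₁₃SepCoPH F 2 θ hP).βfun (fun k => θ.cβ * beta0OfJs F κ k))
    {γ₀ : ℝ} (hγ₀ : 0 < γ₀) (hsc : SurvCont (Node00.datumOfRecord₁₃SepCoPH F 2 θ hP).βfun γ₀) :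
    RunRemAt F κ θ hP θ.cβ := by
  have hγ : 0 < θ.γ := hθ.toStage12.toStage9.gamma_pos
  obtain ⟨e, he, hb⟩ := exists_cornerStep_smul_beta0OfJs F κ θ.cβ
  exact exists_runLetters_of_everyRunConst_survContAt (cβ_mul_stepBal_pos F θ hθ) hA
    (fun s hs => exists_runConstRemainder_of_twoRunShift_cornerStep_scaleAnchor_endRuns hγ hA hT ha hb he hE hs) hγ₀ hsc

/-- ★★ **GIVEN A SUMMABLE TWO-RUN SHIFT AND (ER) AT THE TUPLE, `RunRemAt F κ θ hP θ.cβ` IS EXACTLY «κ ANCHORS ∧ (C) AT SOME POSITIVE LEVEL»** (FILE 5's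
`runRemAt_iff_anchor_survCont_of_runWindowShift` with the run-window text replaced by the two-run texts).  CONDITIONAL. [cite: Balaban1987RG1, Thm 3 p.264 and (2.12)-(2.14) p.268] -/
theorem runRemAt_iff_anchor_survCont_of_twoRunShift_endRuns (hθ : θ.Admissible F 2) {a : ℕ → ℝ} (ha : Summable a)
    (hT : ∀ (k : ℕ) (gs hs : ℕ → ℝ), RGEqH (k + 1) (Node00.datumOfRecord₁₃SepCoPH F 2 θ hP).βfun gs → Step.InInterval θ.γ (k + 1) gs →
      RGEqH k (Node00.datumOfRecord₁₃SepCoPH F 2 θ hP).βfun hs → Step.InInterval θ.γ k hs → hs k = gs (k + 1) →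
      |(Node00.datumOfRecord₁₃SepCoPH F 2 θ hP).βfun (k + 1) (prefixOf gs (k + 1)) - (Node00.datumOfRecord₁₃SepCoPH F 2 θ hP).βfun k (prefixOf hs k)| ≤ a k)
    (hE : ∀ γ' : ℝ, 0 < γ' → γ' ≤ θ.γ → ∀ (k : ℕ) (g : ℝ), 0 < g → g ≤ γ' →
      ∃ hs : ℕ → ℝ, RGEqH k (Node00.datumOfRecord₁₃SepCoPH F 2 θ hP).βfun hs ∧ Step.InInterval γ' k hs ∧ hs k = g) :
    RunRemAt F κ θ hP θ.cβ ↔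
      ScaleAnchor (Node00.datumOfRecord₁₃SepCoPH F 2 θ hP).βfun (fun k => θ.cβ * beta0OfJs F κ k) ∧
        ∃ γ₀ : ℝ, 0 < γ₀ ∧ SurvCont (Node00.datumOfRecord₁₃SepCoPH F 2 θ hP).βfun γ₀ := by
  constructor
  · rintro ⟨γ₀, s, hγ₀, -, -, -, hA', hsc⟩
    exact ⟨hA', γ₀, hγ₀, hsc⟩
  · rintro ⟨hA', γ₀, hγ₀, hsc⟩
    exact runRemAt_of_twoRunShift_scaleAnchor_endRuns_survContAt F κ θ hP hθ ha hT hE hA' hγ₀ hsc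

/-- ★★ **NODE N17 + NODE N22's CURRENCY ⟹ THE TWO-RUN TEXT AT THE RECORD** (with the geometric modulus `a_k := 2(u.cr·u.C₅·u.θ)·u.ρ^k`): node N17 on the datum of record at a
bundle with window `u.γ = θ.γ` and rate `0 < u.ρ < 1` IS box NE4 of the datum's β (`YMDAG.UVSplit.N17At`, FILE 1's `scaleShiftRate_of_n17At_window`); with history moduli
`HistLipschitz Λ θ.γ` of the datum's β whose memory fades at the same rate (`FadingMemory C u.ρ Λ`), the per-pair AF weight bound and node U2's window, §1's
`twoRunShift_of_scaleShift_histLipschitz_fadingMemory` gives (TR).  So ★★ above ∘ this is the two-run road «N17 + moduli + anchor + (C) ⟹ `RunRemAt`».  CONDITIONAL;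
none of the binders is proved. [cite: Balaban1987RG1, (0.20) p.256, (1.20)-(1.22) p.264 and §5 p.298] -/
theorem twoRunShift_of_n17At_histModuli {u : U3Carriers} (hγu : u.γ = θ.γ) (hρ0 : 0 < u.ρ) (hρ1 : u.ρ < 1) (hcr : 0 ≤ u.cr * u.C₅ * u.θ)
    (h17 : N17At (Node00.datumOfRecord₁₃SepCoPH F 2 θ hP) u) {Λ : ℕ → ℕ → ℝ} {C U : ℝ} (hC : 0 ≤ C)
    (hL : HistLipschitz Λ θ.γ (Node00.datumOfRecord₁₃SepCoPH F 2 θ hP).βfun) (hΛ : FadingMemory C u.ρ Λ)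
    (hU : ∀ (K : ℕ) (gA gB : ℕ → ℝ), RGEqH K (Node00.datumOfRecord₁₃SepCoPH F 2 θ hP).βfun gA → Step.InInterval θ.γ K gA →
      RGEqH (K + 1) (Node00.datumOfRecord₁₃SepCoPH F 2 θ hP).βfun gB → Step.InInterval θ.γ (K + 1) gB → gA K = gB (K + 1) →
      ∑ i ∈ range (K + 1), (gA i) ^ 2 * gB (i + 1) ≤ U)
    (hsmall : C * U ≤ (1 - u.ρ) / 2) :
    ∀ (k : ℕ) (gs hs : ℕ → ℝ), RGEqH (k + 1) (Node00.datumOfRecord₁₃SepCoPH F 2 θ hP).βfun gs → Step.InInterval θ.γ (k + 1) gs →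
      RGEqH k (Node00.datumOfRecord₁₃SepCoPH F 2 θ hP).βfun hs → Step.InInterval θ.γ k hs → hs k = gs (k + 1) →
      |(Node00.datumOfRecord₁₃SepCoPH F 2 θ hP).βfun (k + 1) (prefixOf gs (k + 1)) - (Node00.datumOfRecord₁₃SepCoPH F 2 θ hP).βfun k (prefixOf hs k)| ≤
        2 * (u.cr * u.C₅ * u.θ) * u.ρ ^ k :=
  twoRunShift_of_scaleShift_histLipschitz_fadingMemory hρ0 hρ1 hcr hC (scaleShiftRate_of_n17At_window F θ hP hγu h17) hL hΛ hU hsmall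

end Record

/-! ## §3 Model sanity (A6): the binder SET of ★ is jointly satisfiable — the constant family (a TRIVIAL inhabitant, not a model of Bałaban's β) -/

section Model

/-- For the CONSTANT family `β_k ≡ b₀` every IR-matched pair has two-run shift `0`: (TR) with `a ≡ 0` at every level. [folklore] -/
theorem twoRunShift_const (b₀ γ : ℝ) :
    ∀ (k : ℕ) (gs hs : ℕ → ℝ), RGEqH (k + 1) (fun _ _ => b₀) gs → Step.InInterval γ (k + 1) gs → RGEqH k (fun _ _ => b₀) hs →
      Step.InInterval γ k hs → hs k = gs (k + 1) →
      |(fun _ _ => b₀ : HBeta) (k + 1) (prefixOf gs (k + 1)) - (fun _ _ => b₀ : HBeta) k (prefixOf hs k)| ≤ (fun _ => (0 : ℝ)) k := by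
  intro k gs hs _ _ _ _ _
  simp

/-- … with anchor `b ≡ b₀`, corner step `0` and (ER) from `endRuns_of_betaSign_cont_upper` (`0 ≤ b₀`: sign, constant = continuous, upper bound `b₀`), ★ applies and returns
every run-wise constant remainder of the constant family — recorded ONLY to certify that ★'s binders (anchor, (TR), corner step, (ER), `γ > 0`) are JOINTLY satisfiable (A6);
it says nothing about Bałaban's (1.22). [folklore] -/
theorem exists_runConstRemainder_const {b₀ γ : ℝ} (hb₀ : 0 ≤ b₀) (hγ : 0 < γ) {s : ℝ} (hs : 0 < s) :
    ∃ γs : ℝ, 0 < γs ∧ γs ≤ γ ∧ RunConstRemainder (fun _ _ => b₀) (fun _ => b₀) s γs :=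
  exists_runConstRemainder_of_twoRunShift_cornerStep_scaleAnchor_endRuns (a := fun _ => 0) (e := fun _ => 0) hγ
    (fun _ δ hδ => ⟨1, one_pos, fun _ _ => by simpa using hδ.le⟩) (twoRunShift_const b₀ γ) summable_zero (fun _ => by simp) summable_zero
    (endRuns_of_betaSign_cont_upper hb₀ (fun _ => continuousOn_const) (fun _ _ _ => hb₀) (fun _ _ _ => le_rfl)) hs

end Model

end Summit.QuantumFields.YangMills.BalabanUVNodes.N17TwoRunShift

end
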